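import Literature.Analysis.FluidPDE.KwonDecompositionClasses
import Literature.Analysis.FluidPDE.SuitableWeakCongr
import Literature.Analysis.FluidPDE.WeakSpatialGradientSum
import HarnessLib

/-!
# Kwon's Lemma 2.5: the weak gradient of `v = u − h`

Analysis/FluidPDE file on the discharge path of the named fact
`Literature.Analysis.FluidPDE.kwon2023_velocity_epsilon_regularity`
(`PressureFreeEpsilonRegularity.lean`; H. Kwon, J. Differential Equations (2023) =
arXiv:2104.03160, Thm. 1.4), sixteenth brick of Lemma 2.5: the first two conjuncts of the
`localEnergy` field of Def. 2.4 (`Kwon2023.IsPerturbedSuitableOn`) for `v = W − h` — a weak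
spatial gradient `∇v = G − ∇h` on `O ⊆ Q₂(0)` (`G` the CKN weak gradient of `u`, transported to
the representative `W = u` a.e.; `∇h = driftGrad W` from `hasWeakSpatialGradientOn_driftField`),
square integrable over `O` when `∫∫_{Q₂}|G|² < ∞` (`cknE 2 0 G < ⊤`) and `O ⊆ (−4,0) × B₁`
(`∇h` is bounded, `exists_forall_norm_driftGrad_le`). PRINTED: Lemma 2.5 with Def. 2.4
("`∇v ∈ L²(𝒪)`"). The remaining conjunct — the local energy inequality itself — is Kwon's p. 9
argument (see the cell's design memo); no NS-regularity statement is touched.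

## Mathlib / tree search

Tree (reused): `HasWeakSpatialGradientOn.congr_ae` (`SuitableWeakCongr`), `.add`
(`WeakSpatialGradientSum`), `.mono` (`SuitableWeak`); `hasWeakSpatialGradientOn_driftField`
(`KwonDecompositionClasses`); `exists_forall_norm_driftGrad_le` (`KwonDriftBounds`);
`kwonCyl_two_eq_parabolicCylinderOpens`, `coe_kwonCyl_two_eq_parabolicCylinder`, `kwonCyl_one_le_two`
(`KwonDecompositionMomentum`); `frobeniusNormSq` (`VectorCalculus`), `cknE` (`SuitableWeak`).

## References

* H. Kwon, J. Differential Equations (2023) = arXiv:2104.03160: Lemma 2.5, Def. 2.4.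
  [Kwon2023RolePressure]
-/

noncomputable section

open MeasureTheory Set Function Filter Topology TopologicalSpace Metric InnerProductSpace
  ContinuousLinearMap
open scoped NNReal ENNReal RealInnerProductSpace Convolution Laplacian ContDiff

namespace Literature.Analysis.FluidPDE

namespace Kwon2023

variable {W u v : ℝ → EuclideanSpace ℝ (Fin 3) → EuclideanSpace ℝ (Fin 3)}
  {G : ℝ → EuclideanSpace ℝ (Fin 3) → EuclideanSpace ℝ (Fin 3) →L[ℝ] EuclideanSpace ℝ (Fin 3)}
  {O : Opens (ℝ × EuclideanSpace ℝ (Fin 3))}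

/-- `|A − B|²_F ≤ 2|A|²_F + 6‖B‖²` on `ℝ³` (termwise `(a − b)² ≤ 2a² + 2b²` and `‖B eᵢ‖ ≤ ‖B‖`). [folklore] -/
private theorem frobeniusNormSq_sub_le
    (A B : EuclideanSpace ℝ (Fin 3) →L[ℝ] EuclideanSpace ℝ (Fin 3)) :
    frobeniusNormSq (A - B) ≤ 2 * frobeniusNormSq A + 6 * ‖B‖ ^ 2 := by
  unfold frobeniusNormSq
  have hterm : ∀ i, ‖(A - B) (stdOrthonormalBasis ℝ (EuclideanSpace ℝ (Fin 3)) i)‖ ^ 2 ≤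
      2 * ‖A (stdOrthonormalBasis ℝ (EuclideanSpace ℝ (Fin 3)) i)‖ ^ 2 + 2 * ‖B‖ ^ 2 := by
    intro i
    set e := stdOrthonormalBasis ℝ (EuclideanSpace ℝ (Fin 3)) i
    have he : ‖e‖ = 1 := (stdOrthonormalBasis ℝ (EuclideanSpace ℝ (Fin 3))).orthonormal.1 i
    have h1 : ‖(A - B) e‖ ≤ ‖A e‖ + ‖B e‖ := by
      rw [_root_.sub_apply]; exact norm_sub_le _ _
    have h2 : ‖B e‖ ≤ ‖B‖ := by simpa [he] using B.le_opNorm e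
    have h0 : 0 ≤ ‖(A - B) e‖ := norm_nonneg _
    nlinarith [mul_le_mul h1 h1 h0 (by positivity), norm_nonneg (A e), norm_nonneg (B e),
      sq_nonneg (‖A e‖ - ‖B e‖), mul_le_mul h2 h2 (norm_nonneg _) (norm_nonneg _)]
  calc ∑ i, ‖(A - B) (stdOrthonormalBasis ℝ (EuclideanSpace ℝ (Fin 3)) i)‖ ^ 2
      ≤ ∑ i, (2 * ‖A (stdOrthonormalBasis ℝ (EuclideanSpace ℝ (Fin 3)) i)‖ ^ 2 + 2 * ‖B‖ ^ 2) :=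
        Finset.sum_le_sum fun i _ => hterm i
    _ = 2 * ∑ i, ‖A (stdOrthonormalBasis ℝ (EuclideanSpace ℝ (Fin 3)) i)‖ ^ 2 + 6 * ‖B‖ ^ 2 := by
        rw [Finset.sum_add_distrib, Finset.mul_sum, Finset.sum_const, Finset.card_univ,
          Fintype.card_fin, nsmul_eq_mul]
        have h3 : ((Module.finrank ℝ (EuclideanSpace ℝ (Fin 3)) : ℕ) : ℝ) = 3 := by
          rw [finrank_euclideanSpace_fin]; norm_num
        rw [h3]
        ring

/-- **The CKN weak gradient of `u` is a weak gradient of its representative `W`** on `Q₂(0)`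
(`W = u` a.e. there). [cite: Kwon2023RolePressure, Lemma 2.5 with Def. 1.1] -/
theorem hasWeakSpatialGradientOn_repr
    (hG : HasWeakSpatialGradientOn (parabolicCylinderOpens 2 (0 : ℝ × EuclideanSpace ℝ (Fin 3))) u G)
    (hWu : uncurry W =ᵐ[volume] (parabolicCylinder 2 (0 : ℝ × EuclideanSpace ℝ (Fin 3))).indicator (uncurry u)) :
    HasWeakSpatialGradientOn (parabolicCylinderOpens 2 (0 : ℝ × EuclideanSpace ℝ (Fin 3))) W G := by
  refine hG.congr_ae ?_
  have hQ : MeasurableSet (parabolicCylinder 2 (0 : ℝ × EuclideanSpace ℝ (Fin 3))) :=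
    (isOpen_parabolicCylinder 2 _).measurableSet
  rw [coe_parabolicCylinderOpens]
  filter_upwards [ae_restrict_mem hQ, ae_restrict_of_ae hWu] with z hz hz'
  rw [indicator_of_mem hz] at hz'
  exact hz'.symm

/-- **The weak gradient of `v = W − h`** on `O ⊆ Q₂(0)`: `∇v = G − ∇h` with `G` the CKN weak
gradient of `u` and `∇h = driftGrad W`. [cite: Kwon2023RolePressure, Lemma 2.5 with Def. 2.4] -/
theorem hasWeakSpatialGradientOn_sub_driftField (hW : IsGoodVelocity W)
    (hG : HasWeakSpatialGradientOn (parabolicCylinderOpens 2 (0 : ℝ × EuclideanSpace ℝ (Fin 3))) u G)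
    (hWu : uncurry W =ᵐ[volume] (parabolicCylinder 2 (0 : ℝ × EuclideanSpace ℝ (Fin 3))).indicator (uncurry u))
    (hO : O ≤ kwonCyl (-4) 0 1) (hv : ∀ t x, v t x = W t x - driftField W t x) :
    HasWeakSpatialGradientOn O v (fun t x => G t x - driftGrad W t x) := by
  have hO₂ : O ≤ parabolicCylinderOpens 2 (0 : ℝ × EuclideanSpace ℝ (Fin 3)) := by
    rw [← kwonCyl_two_eq_parabolicCylinderOpens]; exact hO.trans kwonCyl_one_le_two
  have hWG : HasWeakSpatialGradientOn O W G := (hasWeakSpatialGradientOn_repr hG hWu).mono hO₂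
  have hh : HasWeakSpatialGradientOn O (fun t x => -driftField W t x) (fun t x => -driftGrad W t x) := by
    have h0 : HasWeakSpatialGradientOn O (driftField W) (driftGrad W) :=
      hasWeakSpatialGradientOn_driftField hW (fun _ _ => rfl) (fun _ _ => rfl)
    refine ⟨?_, ?_, fun φ hφ a w => ?_⟩
    · have e : uncurry (fun t x => -driftField W t x) = -uncurry (driftField W) := rfl
      rw [e]; exact h0.locallyIntegrableOn.neg
    · have e : uncurry (fun t x => -driftGrad W t x) = -uncurry (driftGrad W) := rfl
      rw [e]; exact h0.locallyIntegrableOn_grad.neg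
    · have h1 := h0.integral_fderiv_mul_inner_eq φ hφ a w
      have e1 : (fun t => ∫ x, fderiv ℝ (φ t) x a * ⟪-driftField W t x, w⟫) =
          fun t => -∫ x, fderiv ℝ (φ t) x a * ⟪driftField W t x, w⟫ := by
        funext t; rw [← integral_neg]
        refine integral_congr_ae (Eventually.of_forall fun x => ?_)
        simp only [inner_neg_left, mul_neg]
      have e2 : (fun t => ∫ x, φ t x * ⟪(-driftGrad W t x) a, w⟫) =
          fun t => -∫ x, φ t x * ⟪driftGrad W t x a, w⟫ := by
        funext t; rw [← integral_neg]
        refine integral_congr_ae (Eventually.of_forall fun x => ?_)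
        simp only [_root_.neg_apply, inner_neg_left, mul_neg]
      rw [e1, e2, integral_neg, integral_neg, h1, neg_neg]
  have hsum := hWG.add hh
  have ev : v = fun t x => W t x + -driftField W t x := by
    funext t x; rw [hv, sub_eq_add_neg]
  have eG : (fun t x => G t x - driftGrad W t x) = fun t x => G t x + -driftGrad W t x := by
    funext t x; rw [sub_eq_add_neg]
  rw [ev, eG]
  exact hsum

/-- **`∇v ∈ L²(O)`** for `O ⊆ (−4,0) × B₁`: `∫∫_O |G − ∇h|²_F < ∞` when `∫∫_{Q₂(0)} |G|²_F < ∞`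
(`cknE 2 0 G < ⊤`) — `∇h` is bounded and `O` is bounded. [cite: Kwon2023RolePressure, Lemma 2.5 with Def. 2.4] -/
theorem lintegral_frobeniusNormSq_sub_driftGrad_lt_top (hW : IsGoodVelocity W)
    (hG : HasWeakSpatialGradientOn (parabolicCylinderOpens 2 (0 : ℝ × EuclideanSpace ℝ (Fin 3))) u G)
    (hE : cknE 2 (0 : ℝ × EuclideanSpace ℝ (Fin 3)) G < ⊤) (hO : O ≤ kwonCyl (-4) 0 1) :
    ∫⁻ z in (O : Set (ℝ × EuclideanSpace ℝ (Fin 3))),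
      ENNReal.ofReal (frobeniusNormSq (G z.1 z.2 - driftGrad W z.1 z.2)) < ⊤ := by
  obtain ⟨M, hM⟩ := exists_forall_norm_driftGrad_le hW
  have hO₂ : (O : Set (ℝ × EuclideanSpace ℝ (Fin 3))) ⊆ parabolicCylinder 2 (0 : ℝ × EuclideanSpace ℝ (Fin 3)) := by
    rw [← coe_kwonCyl_two_eq_parabolicCylinder]
    exact fun z hz => kwonCyl_one_le_two (hO hz)
  -- `∫∫_{Q₂} |G|² < ∞`
  have hG2 : ∫⁻ z in parabolicCylinder 2 (0 : ℝ × EuclideanSpace ℝ (Fin 3)),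
      ENNReal.ofReal (frobeniusNormSq (G z.1 z.2)) < ⊤ := by
    have h := hE
    rw [cknE] at h
    have h2 : (ENNReal.ofReal (2 : ℝ))⁻¹ ≠ 0 := by simp
    exact lt_top_iff_ne_top.2 fun htop => (lt_top_iff_ne_top.1 h) (by rw [htop]; exact ENNReal.mul_top h2)
  have hGO : ∫⁻ z in (O : Set (ℝ × EuclideanSpace ℝ (Fin 3))), ENNReal.ofReal (frobeniusNormSq (G z.1 z.2)) < ⊤ :=
    lt_of_le_of_lt (lintegral_mono_set hO₂) hG2
  -- the finite measure of `O`
  have hfin : volume (O : Set (ℝ × EuclideanSpace ℝ (Fin 3))) < ⊤ := by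
    refine lt_of_le_of_lt (measure_mono hO₂) ?_
    rw [parabolicCylinder, Measure.volume_eq_prod, Measure.prod_prod]
    exact ENNReal.mul_lt_top (by simp [Real.volume_Ioo]) measure_ball_lt_top
  -- pointwise bound
  have hpt : ∀ z : ℝ × EuclideanSpace ℝ (Fin 3),
      ENNReal.ofReal (frobeniusNormSq (G z.1 z.2 - driftGrad W z.1 z.2)) ≤
        2 * ENNReal.ofReal (frobeniusNormSq (G z.1 z.2)) + ENNReal.ofReal (6 * M ^ 2) := by
    intro z
    have h1 := frobeniusNormSq_sub_le (G z.1 z.2) (driftGrad W z.1 z.2)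
    have h2 : 6 * ‖driftGrad W z.1 z.2‖ ^ 2 ≤ 6 * M ^ 2 := by
      have := hM z.1 z.2
      nlinarith [norm_nonneg (driftGrad W z.1 z.2)]
    calc ENNReal.ofReal (frobeniusNormSq (G z.1 z.2 - driftGrad W z.1 z.2))
        ≤ ENNReal.ofReal (2 * frobeniusNormSq (G z.1 z.2) + 6 * M ^ 2) :=
          ENNReal.ofReal_le_ofReal (h1.trans (by linarith))
      _ ≤ ENNReal.ofReal (2 * frobeniusNormSq (G z.1 z.2)) + ENNReal.ofReal (6 * M ^ 2) :=
          ENNReal.ofReal_add_le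
      _ = 2 * ENNReal.ofReal (frobeniusNormSq (G z.1 z.2)) + ENNReal.ofReal (6 * M ^ 2) := by
          rw [ENNReal.ofReal_mul zero_le_two, ENNReal.ofReal_ofNat]
  -- measurability of `|G|²` on `O`
  have hfrob_c : Continuous fun L : EuclideanSpace ℝ (Fin 3) →L[ℝ] EuclideanSpace ℝ (Fin 3) => frobeniusNormSq L := by
    unfold frobeniusNormSq
    exact continuous_finsetSum _ fun i _ =>
      ((ContinuousLinearMap.apply ℝ (EuclideanSpace ℝ (Fin 3)) (stdOrthonormalBasis ℝ (EuclideanSpace ℝ (Fin 3)) i)).continuous.norm).pow 2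
  have hGm : AEStronglyMeasurable (uncurry G) (volume.restrict (O : Set (ℝ × EuclideanSpace ℝ (Fin 3)))) := by
    have h0 := hG.locallyIntegrableOn_grad.aestronglyMeasurable
    rw [coe_parabolicCylinderOpens] at h0
    exact h0.mono_measure (Measure.restrict_mono hO₂ le_rfl)
  have h1 : AEMeasurable (fun z : ℝ × EuclideanSpace ℝ (Fin 3) => ENNReal.ofReal (frobeniusNormSq (G z.1 z.2)))
      (volume.restrict (O : Set (ℝ × EuclideanSpace ℝ (Fin 3)))) :=
    ((hfrob_c.comp_aestronglyMeasurable hGm).aemeasurable).ennreal_ofReal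
  have hGm' : AEMeasurable (fun z : ℝ × EuclideanSpace ℝ (Fin 3) => 2 * ENNReal.ofReal (frobeniusNormSq (G z.1 z.2)))
      (volume.restrict (O : Set (ℝ × EuclideanSpace ℝ (Fin 3)))) := h1.const_mul 2
  calc ∫⁻ z in (O : Set (ℝ × EuclideanSpace ℝ (Fin 3))), ENNReal.ofReal (frobeniusNormSq (G z.1 z.2 - driftGrad W z.1 z.2))
      ≤ ∫⁻ z in (O : Set (ℝ × EuclideanSpace ℝ (Fin 3))), (2 * ENNReal.ofReal (frobeniusNormSq (G z.1 z.2)) +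
          ENNReal.ofReal (6 * M ^ 2)) := lintegral_mono fun z => hpt z
    _ = 2 * (∫⁻ z in (O : Set (ℝ × EuclideanSpace ℝ (Fin 3))), ENNReal.ofReal (frobeniusNormSq (G z.1 z.2))) +
          ENNReal.ofReal (6 * M ^ 2) * volume (O : Set (ℝ × EuclideanSpace ℝ (Fin 3))) := by
        rw [lintegral_add_left' hGm', lintegral_const_mul'' _ h1, setLIntegral_const]
    _ < ⊤ := ENNReal.add_lt_top.2 ⟨ENNReal.mul_lt_top (by simp) hGO,
          ENNReal.mul_lt_top ENNReal.ofReal_lt_top hfin⟩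

end Kwon2023

end Literature.Analysis.FluidPDE

end
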